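/-
Copyright: lit-balaban Phase-2 proof seat p08 (gen 8).  Statement-level skeleton of a published paper; no proof claims beyond what
the kernel checks below.
-/
import Literature.MathematicalPhysics.QuantumFieldTheory.BalabanImbrieJaffe1984to88.BIJ88Decay216Prop12
import Literature.MathematicalPhysics.QuantumFieldTheory.BalabanImbrieJaffe1984to88.BIJ85Prop522Rescaling

/-!
# `BalabanImbrieJaffe1984to88.BIJ85CurlyDkDecayTorus` — T. Bałaban, J. Imbrie, A. Jaffe, *Renormalization of the Higgs model:
minimizers, propagators and the stability of mean field theory*, Commun. Math. Phys. **97** (1985) 299–329 [BalabanImbrieJaffe1985]: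
Sect. 7.2, p. 326, **the exponential decay of the propagator `𝒟_k = Σ_{j<k} H_jC^{(j)}H_j*` (4.4.4) ON THE TORI OF THE SERIES FOR THE
`𝒟_k` OF RECORD** (p11's `BIJ85Prop522Torus.DkE P η_k^d L^k k`), **GIVEN ONLY [6I] PROPOSITION 1.2 BY ITS TREE NAME** (`B5.Prop12Printed`)

statement-level skeleton of published theorems with citation tags; proofs where landed; nothing here is a claim about the Yang–Mills mass gap

PDF held: `paper:balaban1985-cmp97-bij-higgs-minimizers` (journal page = PDF page + 298), p. 312 [PDF 14], p. 326 [PDF 28] (text layer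
`~/.lit/texts/paper-balaban1985-cmp97-bij-higgs-minimizers/p0014.txt`, `p0028.txt`, re-read this session); [6I] = [Balaban1984PropagatorsI]
Prop. 1.2 (tree name `Balaban1983to89.B5.Prop12Printed`); C2 = [BalabanImbrieJaffe1988] p. 261 (2.12)–(2.13).

CITATION HEADER (lean-in-tree rule).  Part of the lit-balaban TYPED SKELETON (HOME `run/shared/lean/pub/lit-balaban/`), Phase-2 proof
seat p08 (gen 8), unit `lit-balaban-p08`; WHAT IS REPRODUCED = the located sentence of SKELETON row **C1.Eq7.2.4** (owner r15, referee
ref-5; head `proved` for the display (7.2.4)) *"the operators 𝒟_k have the properties of G_k in [6I] Prop 1.2 (exponential decay,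
singularities on the diagonal) by (4.4.4)"*, for the `𝒟_k` of record of rows **C1.Eq4.4.4** / **C2.Eq2.12** (`DkE`), kind «model instance»:
the decay member PROVED on the tori from `B5.Prop12Printed` alone; the diagonal member recorded as r18's exact scaling identity.  TAKING
line HOME/STATUS.md 2026-08-21T19:11:39Z.  Decls used BY NAME (nothing restated): p11's `DkE`/`HkE`/`CE`; p08 g7's
`BIJ88SigmaKernelDkTorus.inner_DkE_eq_sum`, `BIJ88Ineq217Ineq722Torus.ofLp_HkE_single`/`exists_bound_of_ineq722`,
`BIJ88Decay216Torus.triple_sum_le`; r18's `BIJ88Decay216Native.abs_inner_cE_ambient_le`, `BIJ85Prop522Rescaling.dkE_eta_eq`; p09's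
`BIJ85Ineq723TorusCE.ineq723_CE_lt` (via p08's `BIJ88Decay216Prop12.ineq723_CE_torus`), `ineq722_deltaA_of_prop12Printed`, `torusRep`/
`distEU`/`levStd`; r15's typed `BIJ85Sect7Statements.KernelData.Ineq722`.

THE PRINTED TEXT (p. 326 [PDF 28], verbatim, after (7.2.4)): *"The operators 𝒟_k have the same properties as the operators G_k in [6I],
Proposition 1.2, with exponential decay but singularities on the diagonal. These properties follow from (4.4.4) and the above estimates on
H_k, C^{(k)}."*; p. 312 [PDF 14]: *"Let 𝒟_k = Σ_{j=0}^{k−1} H_jC^{(j)}H_j*. (4.4.4) Here the transformations H_j are now defined by the same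
formulas as (4.4.2); however, they act on the η = L^{−k} lattice instead of the L^{−j} lattice and they involve j order averages Q_j.
Similarly the propagators C^{(j)} are defined by the formula (4.3.3) but on the L^jη = L^{j−k} lattice, rather than on the unit lattice."*;
"the above estimates" = (7.2.2) *"|H_{k,μν}(x,y)| + … ≤ Me^{−δ|x−y|}"* and (7.2.3) *"|C^{(k)}_{μν}(x,y)| ≦ Me^{−δ|x−y|}"* (p. 325).

THE TORUS DATA (all in the tree): tori `Balaban1983to89.Setup`/`Params` (`d ≥ 2`, block size `L`, standing range `k ≤ m + K`,
`η_k = L^{−k}`); `η`-bonds `PBond P 0` with the `ℓ^∞` torus distance `supDist` (`|b₋ − b″₋|_∞/L^k` = the distance in the unit `L^kη = 1`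
of `T₁^{(k)}`, the normalisation of p09's `distEU`); p11's `𝒟_k = DkE P w c k = Σ_{j<k} HkE ∘ CE ∘ HkE†` on the Euclidean bond space at the
printed weights `(w, c) = (η_k^d, L^k)` of step `k` (as in C2's `sigmaTorus`, `CkE`); its KERNEL `𝒟_k(b, b″) := (𝒟_ke_{b″})(b)`,
`e_{b″} = toE P (Pi.single b″ 1)`; the scale-`j` Landau kernels `H_{j,μν}(x; y)` of p09's `torusRep P j (deltaAData …)` (`G = Δ_a⁻¹`); the
unit-lattice matrices `⟨e_{b₁}, C^{(j)}e_{b₂}⟩` of p11's `CE P η_j^d L^j j`.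

WHAT IS PROVED (0 `sorry`, standard axioms; theorems only — proof lane; every `d ≥ 2`):
* §1 **`dkKernel_eq_sum`** ((4.4.4) entrywise): `𝒟_k(b, b″) = Σ_{j<k}Σ_{b₁,b₂∈T^{(j)}} H_j(b, b₁)C^{(j)}(b₁, b₂)H_j(b″, b₂)`;
  **`dkKernel_eta_eq`**: `𝒟_k(b, b″) = (L^k)^{d−2}·𝒟_k^{(1,1)}(b, b″)` — the factor `η^{−(d−2)}` of the «singularities on the diagonal».
* §2 **`abs_termDk_le`**: the scale-`j` term is at most `M²M_C(L^{k−j})^{d−2}·d²e^{a/2}K(a)²·e^{−a|b₋−b″₋|_∞/L^j}`, `a = min(δ, δ_C)/2`,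
  from the sup member of (7.2.2) for `H_j` and (7.2.3) for the unit-lattice `C^{(j)}` (the factor `(L^{k−j})^{d−2}` is p. 312's
  *"C^{(j)} … on the L^jη lattice, rather than on the unit lattice"*, r18's `cE_ambient_eq_native`).
* §3 **`abs_dkKernel_le`**: for `D = |b₋ − b″₋|_∞/L^k ≥ 2`, `|𝒟_k(b, b″)| ≤ M²M_C·d²e^{a/2}K(a)²·(d−1)!/a^{d−1}·e^{−(a/2)D}`, uniform in `k`.
* §4 **`decayDk_torus_of_ineq722_lt`** (from r15's typed (7.2.2) for p09's kernel family + the native (7.2.3), binder shape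
  `∀ k ≤ m + K, ∀ j < k`) and **`decayDk_torus_prop12`**: `∃ R₀ c₀ δ′, 0 < δ′ ∧ 0 ≤ c₀ ∧ ∀ k ≤ m + K, ∀ b b″, R₀ ≤ |b₋ − b″₋|_∞/L^k →
  |𝒟_k(b, b″)| ≤ c₀e^{−δ′|b₋ − b″₋|_∞/L^k}` GIVEN ONLY `B5.Prop12Printed` ((7.2.3) hypothesis-free by p09).
HONEST SCOPE.  (i) Only the DECAY member is proved as an inequality; «singularities on the diagonal» ([6I] Prop. 1.2's `d(x,x′)^{−(d−2)}`)
is represented by the exact normalisation identity `dkKernel_eta_eq` only — no lower bound, no short-distance bound, no derivative/Hölder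
members.  (ii) The remaining hypothesis is [6I] Proposition 1.2 BY NAME for the torus settings `settingOf (torusRep P (levStd P i) …) i`
(the `h12` of rows C1.Eq7.2.1-7.2.2 / C2.Eq2.16); its constants, hence `(R₀, c₀, δ′)`, are existential PER TORUS `P` (uniform in
`k ≤ m + K`; p09's (7.2.3) constants depend on `(d, L)` only).  (iii) `ℓ^∞` distances in the unit `L^kη` (`ℓ¹ ≤ d·ℓ^∞`); threshold `2`, constants explicit,
not optimal; `U = 1`, real abelian fields, torus, standing range.  (iv) This is the UNLOCALIZED `𝒟_k`; C2's (2.13) for `𝒟_{k,loc}` is row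
C2.Eq2.13's business.  (v) No `def`, no new named fact, nothing restated; NOT summit progress.  Unit `lit-balaban-p08`
(literature-prover-lit-balaban-p08-g8-0), 2026-08-21.
-/

open scoped BigOperators RealInnerProductSpace

namespace Literature.MathematicalPhysics.QuantumFieldTheory.BalabanImbrieJaffe1984to88.BIJ85CurlyDkDecayTorus

open Balaban1983to89 hiding Site Plaq
open Balaban1983to89.LatticeFieldCalculus
open BIJ88SigmaKernelDkTorus BIJ88Ineq217Ineq722Torus BIJ88Decay216Torus
open BIJ85AxialPropagator411 BIJ85Prop521Torus BIJ85Prop522Torus BIJ85Sigma422Eta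
open BIJ85Sect7Statements BIJ85Ineq722Torus BIJ85Eq721MinimizerKernel
open BIJ85Ineq722DeltaA (deltaAData ineq722_deltaA_of_prop12Printed)
open BIJ85Ineq722ProofPart2 (settingOf)
open BIJ88Decay216Native (abs_inner_cE_ambient_le)
open BIJ88Decay216Prop12 (ineq723_CE_torus)
open BIJ85Prop522Rescaling (dkE_eta_eq)
open BIJ85Ineq723TorusCE (inner_toEj_single_left toEj_single)
-- inside this namespace the bare `Site`/`Plaq` are the `ℤ^d` carriers of the QFT root; the torus ones are renamed:
open Balaban1983to89 renaming Site → TSite, Plaq → TPlaq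

noncomputable section

variable {P : Params}

/-! ## §1  The kernel of `𝒟_k` through the kernels of `H_j` and `C^{(j)}` ((4.4.4) entrywise) -/

/-- the coordinates of the image of a linear map of Euclidean spaces through the coordinates of the argument:
`(Tv)_i = Σ_j v_j·(Te_j)_i`. [folklore] -/
private theorem apply_eq_sum_single {ι κ : Type*} [Fintype ι] [DecidableEq ι]
    (T : EuclideanSpace ℝ ι →ₗ[ℝ] EuclideanSpace ℝ κ) (v : EuclideanSpace ℝ ι) (i : κ) :
    T v i = ∑ j, v j * T (EuclideanSpace.single j 1) i := by
  conv_lhs => rw [← (EuclideanSpace.basisFun ι ℝ).sum_repr v]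
  rw [map_sum, WithLp.ofLp_sum, Finset.sum_apply]
  refine Finset.sum_congr rfl fun j _ => ?_
  rw [EuclideanSpace.basisFun_repr, EuclideanSpace.basisFun_apply, map_smul, WithLp.ofLp_smul, Pi.smul_apply,
    smul_eq_mul]

/-- a pairing of Euclidean vectors through the coordinates: `⟨u, x⟩ = Σ_i u_i x_i`. [folklore] -/
private theorem inner_eq_sum_coord {ι : Type*} [Fintype ι] [DecidableEq ι] (u x : EuclideanSpace ℝ ι) :
    ⟪u, x⟫ = ∑ i, u i * x i := by
  conv_lhs => rw [← (EuclideanSpace.basisFun ι ℝ).sum_repr u]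
  rw [sum_inner]
  refine Finset.sum_congr rfl fun i _ => ?_
  rw [EuclideanSpace.basisFun_repr, EuclideanSpace.basisFun_apply, real_inner_smul_left, EuclideanSpace.inner_single_left,
    map_one, one_mul]

/-- a coordinate of the adjoint: `(T†g)_i = ⟨Te_i, g⟩`. [folklore] -/
private theorem adjoint_apply_coord {ι κ : Type*} [Fintype ι] [DecidableEq ι] [Fintype κ]
    (T : EuclideanSpace ℝ ι →ₗ[ℝ] EuclideanSpace ℝ κ) (g : EuclideanSpace ℝ κ) (i : ι) :
    LinearMap.adjoint T g i = ⟪T (EuclideanSpace.single i 1), g⟫ := by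
  have h := EuclideanSpace.inner_single_left i (1 : ℝ) (LinearMap.adjoint T g)
  rw [map_one, one_mul] at h
  rw [← h, LinearMap.adjoint_inner_right]

/-- the bond basis vector of `BondSpace P`: `ι(δ_b) = e_b`. [folklore] -/
private theorem toE_single [DecidableEq (PBond P 0)] (b : PBond P 0) (a : ℝ) :
    toE P (Pi.single b a) = EuclideanSpace.single b a := rfl

/-- **the columns of `H_j*` are the rows of `H_j`**: `(H_j*e_b)(b₁) = (H_je_{b₁})(b) =: H_j(b, b₁)` (any weights).
[cite: BalabanImbrieJaffe1985, (4.4.4) p.312] -/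
theorem adjoint_HkE_single_apply (w c : ℝ) (j : ℕ) (b : PBond P 0) (b₁ : PBond P j) :
    LinearMap.adjoint (HkE P w c j) (toE P (Pi.single b 1)) b₁ = HkE P w c j (toEj P j (Pi.single b₁ 1)) b := by
  classical
  rw [adjoint_apply_coord, toE_single, toEj_single, EuclideanSpace.inner_single_right, one_mul, starRingEnd_apply,
    star_trivial]

/-- a pairing `⟨u, C^{(j)}v⟩` through the matrix `C^{(j)}(b₁, b₂) = ⟨e_{b₁}, C^{(j)}e_{b₂}⟩`:
`⟨u, C^{(j)}v⟩ = Σ_{b₁,b₂} u(b₁)C^{(j)}(b₁, b₂)v(b₂)`. [cite: BalabanImbrieJaffe1985, (4.3.5) p.311] -/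
theorem inner_CE_eq_sum (w c : ℝ) (j : ℕ) (u v : CoarseSpace P j) :
    ⟪u, CE P w c j v⟫ = ∑ b₁ : PBond P j, ∑ b₂ : PBond P j,
      u b₁ * ⟪toEj P j (Pi.single b₁ 1), CE P w c j (toEj P j (Pi.single b₂ 1))⟫ * v b₂ := by
  classical
  rw [inner_eq_sum_coord]
  refine Finset.sum_congr rfl fun b₁ _ => ?_
  rw [apply_eq_sum_single (CE P w c j) v b₁, Finset.mul_sum]
  refine Finset.sum_congr rfl fun b₂ _ => ?_
  rw [inner_toEj_single_left, toEj_single]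
  ring

/-- **THE KERNEL OF `𝒟_k` ((4.4.4) ENTRYWISE)**: `𝒟_k(b, b″) := (𝒟_ke_{b″})(b) = Σ_{j<k}Σ_{b₁,b₂∈T^{(j)}} H_j(b, b₁)·C^{(j)}(b₁, b₂)·H_j(b″, b₂)`,
`H_j(b, b₁) = (H_je_{b₁})(b)` ((7.2.1), p11's `HkE`), `C^{(j)}(b₁, b₂) = ⟨e_{b₁}, C^{(j)}e_{b₂}⟩` (p11's `CE`); any weights, every `k`.
[cite: BalabanImbrieJaffe1985, (4.4.4) p.312] -/
theorem dkKernel_eq_sum (w c : ℝ) (k : ℕ) (b b'' : PBond P 0) :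
    DkE P w c k (toE P (Pi.single b'' 1)) b = ∑ j ∈ Finset.range k, ∑ b₁ : PBond P j, ∑ b₂ : PBond P j,
      HkE P w c j (toEj P j (Pi.single b₁ 1)) b *
        ⟪toEj P j (Pi.single b₁ 1), CE P w c j (toEj P j (Pi.single b₂ 1))⟫ *
        HkE P w c j (toEj P j (Pi.single b₂ 1)) b'' := by
  classical
  have h0 : DkE P w c k (toE P (Pi.single b'' 1)) b = ⟪toE P (Pi.single b 1), DkE P w c k (toE P (Pi.single b'' 1))⟫ := by
    rw [toE_single b, EuclideanSpace.inner_single_left, map_one, one_mul]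
  rw [h0, inner_DkE_eq_sum]
  refine Finset.sum_congr rfl fun j _ => ?_
  rw [inner_CE_eq_sum]
  refine Finset.sum_congr rfl fun b₁ _ => Finset.sum_congr rfl fun b₂ _ => ?_
  rw [adjoint_HkE_single_apply, adjoint_HkE_single_apply]

/-- **«singularities on the diagonal»: the normalisation of step `k`** — at the printed weights `(η_k^d, L^k)` the kernel is
`(L^k)^{d−2} = η^{−(d−2)}` times the weight-free one (r18's `dkE_eta_eq`; `k ≤ m + K + 1`, `d ≥ 2`). [cite: BalabanImbrieJaffe1985, (4.4.4) p.312] -/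
theorem dkKernel_eta_eq (hd : 2 ≤ P.d) {k : ℕ} (hk : k ≤ P.m + P.K + 1) (b b'' : PBond P 0) :
    DkE P ((P.eta k) ^ P.d) ((P.L : ℝ) ^ k) k (toE P (Pi.single b'' 1)) b =
      ((P.L : ℝ) ^ k) ^ (P.d - 2) * DkE P 1 1 k (toE P (Pi.single b'' 1)) b := by
  rw [dkE_eta_eq hd hk, LinearMap.smul_apply, WithLp.ofLp_smul, Pi.smul_apply, smul_eq_mul]

/-! ## §2  The scale-`j` term: «the above estimates on H_k, C^{(k)}» -/

/-- `Σ_b f(b₋) = d·Σ_y f(y)` on `T^{(j)}`. [folklore] -/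
private theorem sum_bond_src {j : ℕ} (f : TSite P j → ℝ) : ∑ b : PBond P j, f b.src = (P.d : ℝ) * ∑ y : TSite P j, f y := by
  rw [← Fintype.sum_equiv (LatticeFieldCalculus.bondEquiv (P := P) (j := j)) (fun q : TSite P j × Fin P.d => f q.1) _
    (fun q => rfl), Fintype.sum_prod_type]
  simp only [Finset.sum_const, Finset.card_univ, Fintype.card_fin, nsmul_eq_mul]
  rw [Finset.mul_sum]

/-- `0 < L^n`. [folklore] -/
private theorem cast_pow_L_pos' (n : ℕ) : (0 : ℝ) < (P.L : ℝ) ^ n := pow_pos P.cast_L_pos n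

/-- **THE SCALE-`j` TERM OF `𝒟_k(b, b″)` AT THE WEIGHTS OF STEP `k`** (`j ≤ k`, `j ≤ m + K`, every `d ≥ 2`): given the sup member of (7.2.2)
for the scale-`j` Landau kernel (`|x − y|` = p09's `distEU P j`) and (7.2.3) for the UNIT-LATTICE matrix of `C^{(j)}`, the term is at most
`M²·M_C(L^{k−j})^{d−2}·d²e^{a/2}K(a)²·e^{−a|b₋−b″₋|_∞/L^j}`, `a = min(δ, δ_C)/2`, `K(a) = (2(1 + d/a))^d` — r18's rescaling `abs_inner_cE_ambient_le`
(p. 312 *"C^{(j)} … on the L^jη lattice, rather than on the unit lattice"*) and p08's `triple_sum_le`. [cite: BalabanImbrieJaffe1985, (4.4.4) p.312] -/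
theorem abs_termDk_le (hd : 2 ≤ P.d) {k j : ℕ} (hj : j ≤ P.m + P.K) (hjk : j ≤ k) {a : ℝ} (ha : 0 < a)
    {δ M δC MC : ℝ} (hδ : 0 < δ) (hδC : 0 < δC)
    (hH : ∀ (μ ν : Fin P.d) (x : TSite P 0) (y : TSite P j),
      |(torusRep P j (deltaAData hj a)).H (x, μ) (y, ν)| ≤ M * Real.exp (-(δ * distEU P j x y)))
    (hC : ∀ b₁ b₂ : PBond P j, |⟪toEj P j (Pi.single b₁ 1),
      CE P ((P.eta j) ^ P.d) ((P.L : ℝ) ^ j) j (toEj P j (Pi.single b₂ 1))⟫| ≤ MC * Real.exp (-(δC * (supDist b₁.src b₂.src : ℝ))))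
    (b b'' : PBond P 0) :
    |∑ b₁ : PBond P j, ∑ b₂ : PBond P j,
        HkE P ((P.eta k) ^ P.d) ((P.L : ℝ) ^ k) j (toEj P j (Pi.single b₁ 1)) b *
          ⟪toEj P j (Pi.single b₁ 1), CE P ((P.eta k) ^ P.d) ((P.L : ℝ) ^ k) j (toEj P j (Pi.single b₂ 1))⟫ *
          HkE P ((P.eta k) ^ P.d) ((P.L : ℝ) ^ k) j (toEj P j (Pi.single b₂ 1)) b''| ≤
      M ^ 2 * (MC * ((P.L : ℝ) ^ (k - j)) ^ (P.d - 2)) * (P.d : ℝ) ^ 2 *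
        (Real.exp (min δ δC / 2 / 2) * ((2 * (1 + P.d / (min δ δC / 2))) ^ P.d) ^ 2) *
        Real.exp (-(min δ δC / 2 * ((supDist b.src b''.src : ℝ) / (P.L : ℝ) ^ j))) := by
  have hw : 0 < (P.eta k) ^ P.d := pow_pos (eta_pos P k) _
  have hc : (P.L : ℝ) ^ k ≠ 0 := (cast_pow_L_pos' k).ne'
  have hM : 0 ≤ M := by
    have h := hH ⟨0, P.hd⟩ ⟨0, P.hd⟩ default default
    exact (mul_nonneg_iff_of_pos_right (Real.exp_pos _)).1 ((abs_nonneg _).trans h)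
  have hMC : 0 ≤ MC := by
    have h := hC ⟨default, ⟨0, P.hd⟩⟩ ⟨default, ⟨0, P.hd⟩⟩
    exact (mul_nonneg_iff_of_pos_right (Real.exp_pos _)).1 ((abs_nonneg _).trans h)
  have hH' : ∀ (b₀ : PBond P 0) (b₁ : PBond P j),
      |HkE P ((P.eta k) ^ P.d) ((P.L : ℝ) ^ k) j (toEj P j (Pi.single b₁ 1)) b₀| ≤ M * Real.exp (-(δ * distEU P j b₀.src b₁.src)) := by
    intro b₀ b₁
    have e : HkE P ((P.eta k) ^ P.d) ((P.L : ℝ) ^ k) j (toEj P j (Pi.single b₁ 1)) b₀ =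
        (torusRep P j (deltaAData hj a)).H (b₀.src, b₀.dir) (b₁.src, b₁.dir) := ofLp_HkE_single hj hc hw ha b₁ b₀.src b₀.dir
    rw [e]
    exact hH _ _ _ _
  have hC' := abs_inner_cE_ambient_le hd hjk hC
  -- termwise bound
  have hpt : ∀ b₁ b₂ : PBond P j,
      |HkE P ((P.eta k) ^ P.d) ((P.L : ℝ) ^ k) j (toEj P j (Pi.single b₁ 1)) b *
          ⟪toEj P j (Pi.single b₁ 1), CE P ((P.eta k) ^ P.d) ((P.L : ℝ) ^ k) j (toEj P j (Pi.single b₂ 1))⟫ *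
          HkE P ((P.eta k) ^ P.d) ((P.L : ℝ) ^ k) j (toEj P j (Pi.single b₂ 1)) b''| ≤
        M ^ 2 * (MC * ((P.L : ℝ) ^ (k - j)) ^ (P.d - 2)) * (Real.exp (-(δ * distEU P j b.src b₁.src)) * Real.exp (-(δC * (supDist b₁.src b₂.src : ℝ))) *
          Real.exp (-(δ * distEU P j b''.src b₂.src))) := by
    intro b₁ b₂
    rw [abs_mul, abs_mul]
    have h1 := hH' b b₁
    have h2 := hH' b'' b₂
    have h3 := hC' b₁ b₂
    calc _ ≤ (M * Real.exp (-(δ * distEU P j b.src b₁.src))) *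
          (MC * ((P.L : ℝ) ^ (k - j)) ^ (P.d - 2) * Real.exp (-(δC * (supDist b₁.src b₂.src : ℝ)))) *
          (M * Real.exp (-(δ * distEU P j b''.src b₂.src))) :=
          mul_le_mul (mul_le_mul h1 h3 (abs_nonneg _) (by positivity)) h2 (abs_nonneg _) (by positivity)
      _ = _ := by ring
  calc _ ≤ ∑ b₁ : PBond P j, ∑ b₂ : PBond P j, M ^ 2 * (MC * ((P.L : ℝ) ^ (k - j)) ^ (P.d - 2)) * (Real.exp (-(δ * distEU P j b.src b₁.src)) *
          Real.exp (-(δC * (supDist b₁.src b₂.src : ℝ))) * Real.exp (-(δ * distEU P j b''.src b₂.src))) :=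
        (Finset.abs_sum_le_sum_abs _ _).trans (Finset.sum_le_sum fun b₁ _ =>
          (Finset.abs_sum_le_sum_abs _ _).trans (Finset.sum_le_sum fun b₂ _ => hpt b₁ b₂))
    _ = M ^ 2 * (MC * ((P.L : ℝ) ^ (k - j)) ^ (P.d - 2)) * ((P.d : ℝ) * ∑ y : TSite P j, (P.d : ℝ) * ∑ y' : TSite P j, Real.exp (-(δ * distEU P j b.src y)) *
          Real.exp (-(δC * (supDist y y' : ℝ))) * Real.exp (-(δ * distEU P j b''.src y'))) := by
        rw [← sum_bond_src (fun y => (P.d : ℝ) * ∑ y' : TSite P j, Real.exp (-(δ * distEU P j b.src y)) *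
          Real.exp (-(δC * (supDist y y' : ℝ))) * Real.exp (-(δ * distEU P j b''.src y'))), Finset.mul_sum]
        refine Finset.sum_congr rfl fun b₁ _ => ?_
        rw [← sum_bond_src (fun y' => Real.exp (-(δ * distEU P j b.src b₁.src)) * Real.exp (-(δC * (supDist b₁.src y' : ℝ))) *
          Real.exp (-(δ * distEU P j b''.src y'))), Finset.mul_sum]
    _ = M ^ 2 * (MC * ((P.L : ℝ) ^ (k - j)) ^ (P.d - 2)) * (P.d : ℝ) ^ 2 * ∑ y : TSite P j, ∑ y' : TSite P j, Real.exp (-(δ * distEU P j b.src y)) *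
          Real.exp (-(δC * (supDist y y' : ℝ))) * Real.exp (-(δ * distEU P j b''.src y')) := by
        rw [← Finset.mul_sum]; ring
    _ ≤ M ^ 2 * (MC * ((P.L : ℝ) ^ (k - j)) ^ (P.d - 2)) * (P.d : ℝ) ^ 2 * (Real.exp (min δ δC / 2 / 2) * ((2 * (1 + P.d / (min δ δC / 2))) ^ P.d) ^ 2 *
          Real.exp (-(min δ δC / 2 * ((supDist b.src b''.src : ℝ) / (P.L : ℝ) ^ j)))) :=
        mul_le_mul_of_nonneg_left (triple_sum_le hj hδ hδC b.src b''.src) (by positivity)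
    _ = _ := by ring

/-! ## §3  The multiscale sum: exponential decay of `𝒟_k(b, b″)` away from the diagonal -/

/-- `x^q·e^{−ax} ≤ (q+1)!/(a^{q+1}x)` (`a, x > 0`; r18 g8 / p08 g8 private lemma, re-proved). [folklore] -/
private theorem pow_mul_exp_neg_le {a x : ℝ} (ha : 0 < a) (hx : 0 < x) (q : ℕ) :
    x ^ q * Real.exp (-(a * x)) ≤ ((q + 1).factorial : ℝ) / (a ^ (q + 1) * x) := by
  have h := Real.pow_div_factorial_le_exp (a * x) (by positivity) (q + 1)
  rw [div_le_iff₀ (by positivity)] at h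
  rw [le_div_iff₀ (by positivity)]
  calc x ^ q * Real.exp (-(a * x)) * (a ^ (q + 1) * x) = (a * x) ^ (q + 1) * Real.exp (-(a * x)) := by ring
    _ ≤ Real.exp (a * x) * ((q + 1).factorial : ℝ) * Real.exp (-(a * x)) := mul_le_mul_of_nonneg_right h (Real.exp_pos _).le
    _ = ((q + 1).factorial : ℝ) := by
        rw [mul_comm (Real.exp _), mul_assoc, ← Real.exp_add, add_neg_cancel, Real.exp_zero, mul_one]

/-- `Σ_{j<k} L^{−(k−j)} ≤ 1` (`L ≥ 2`; induction: `S_{k+1} = L⁻¹(S_k + 1)`). [folklore] -/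
private theorem sum_inv_pow_le_one (k : ℕ) : ∑ j ∈ Finset.range k, ((P.L : ℝ) ^ (k - j))⁻¹ ≤ 1 := by
  have hL : (2 : ℝ) ≤ P.L := by exact_mod_cast P.hL.2
  induction k with
  | zero => simp
  | succ k ih =>
    have e : ∑ j ∈ Finset.range (k + 1), ((P.L : ℝ) ^ (k + 1 - j))⁻¹ =
        (P.L : ℝ)⁻¹ * (∑ j ∈ Finset.range k, ((P.L : ℝ) ^ (k - j))⁻¹ + 1) := by
      rw [Finset.sum_range_succ, show k + 1 - k = 1 by omega, pow_one, mul_add, mul_one, Finset.mul_sum]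
      refine congrArg (· + _) (Finset.sum_congr rfl fun j hj => ?_)
      rw [show k + 1 - j = (k - j) + 1 by have := Finset.mem_range.1 hj; omega, pow_succ, mul_inv, mul_comm]
    rw [e]
    calc (P.L : ℝ)⁻¹ * (∑ j ∈ Finset.range k, ((P.L : ℝ) ^ (k - j))⁻¹ + 1) ≤ 2⁻¹ * (1 + 1) :=
          mul_le_mul ((inv_le_inv₀ (by linarith) two_pos).2 hL) (by linarith) (by positivity) (by norm_num)
      _ = 1 := by norm_num

/-- `L^k = L^j·L^{k−j}` for `j ≤ k`. [folklore] -/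
private theorem pow_eq_pow_mul_pow' {j k : ℕ} (hjk : j ≤ k) : (P.L : ℝ) ^ k = (P.L : ℝ) ^ j * (P.L : ℝ) ^ (k - j) := by
  rw [← pow_add, Nat.add_sub_cancel' hjk]

/-- **EXPONENTIAL DECAY OF `𝒟_k(b, b″)` ON THE TORI, explicit constants, every `d ≥ 2`**: for `D := |b₋ − b″₋|_∞/L^k ≥ 2` (unit `L^kη = 1`)
and `a = min(δ, δ_C)/2`, `|𝒟_k(b, b″)| ≤ M²M_C·d²e^{a/2}K(a)²·(d−1)!/a^{d−1}·e^{−(a/2)D}`, GIVEN the sup member of (7.2.2) for every `H_j`, `j < k`,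
and (7.2.3) for the unit-lattice matrices of `C^{(j)}`, `j < k`: the scale-`j` term of §2 is `≲ ℓ^{d−2}e^{−aℓD} ≤ ℓ^{d−2}e^{−aℓ}·e^{−(a/2)D}`
(`ℓ = L^{k−j}`), `ℓ^{d−2}e^{−aℓ} ≤ (d−1)!/(a^{d−1}ℓ)`, `Σ_{j<k}ℓ⁻¹ ≤ 1` — *"These properties follow from (4.4.4) and the above estimates on
H_k, C^{(k)}"*. [cite: BalabanImbrieJaffe1985, (4.4.4) p.312] -/
theorem abs_dkKernel_le (hd : 2 ≤ P.d) {k : ℕ} (hk : k ≤ P.m + P.K) {a : ℝ} (ha : 0 < a) {δ M δC MC : ℝ} (hδ : 0 < δ)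
    (hδC : 0 < δC) (hMC : 0 ≤ MC)
    (hH : ∀ (j : ℕ) (hj : j ≤ P.m + P.K), j < k → ∀ (μ ν : Fin P.d) (x : TSite P 0) (y : TSite P j),
      |(torusRep P j (deltaAData hj a)).H (x, μ) (y, ν)| ≤ M * Real.exp (-(δ * distEU P j x y)))
    (hC : ∀ j < k, ∀ b₁ b₂ : PBond P j, |⟪toEj P j (Pi.single b₁ 1),
      CE P ((P.eta j) ^ P.d) ((P.L : ℝ) ^ j) j (toEj P j (Pi.single b₂ 1))⟫| ≤ MC * Real.exp (-(δC * (supDist b₁.src b₂.src : ℝ))))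
    {b b'' : PBond P 0} (hD : 2 ≤ (supDist b.src b''.src : ℝ) / (P.L : ℝ) ^ k) :
    |DkE P ((P.eta k) ^ P.d) ((P.L : ℝ) ^ k) k (toE P (Pi.single b'' 1)) b| ≤
      M ^ 2 * MC * ((P.d : ℝ) ^ 2 * (Real.exp (min δ δC / 2 / 2) * ((2 * (1 + P.d / (min δ δC / 2))) ^ P.d) ^ 2)) *
          (((P.d - 2 + 1).factorial : ℝ) / (min δ δC / 2) ^ (P.d - 2 + 1)) *
        Real.exp (-(min δ δC / 2 / 2 * ((supDist b.src b''.src : ℝ) / (P.L : ℝ) ^ k))) := by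
  set a₀ : ℝ := min δ δC / 2 with ha₀
  have ha₀p : 0 < a₀ := by rw [ha₀]; exact half_pos (lt_min hδ hδC)
  set D : ℝ := (supDist b.src b''.src : ℝ) / (P.L : ℝ) ^ k with hDdef
  set K : ℝ := (P.d : ℝ) ^ 2 * (Real.exp (a₀ / 2) * ((2 * (1 + P.d / a₀)) ^ P.d) ^ 2) with hK
  have hD1 : 1 ≤ D := by linarith
  rw [dkKernel_eq_sum]
  -- the scale-`j` term against the scaling factor `(L^{k−j})^{d−2}`
  have hterm : ∀ j ∈ Finset.range k,
      |∑ b₁ : PBond P j, ∑ b₂ : PBond P j,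
        HkE P ((P.eta k) ^ P.d) ((P.L : ℝ) ^ k) j (toEj P j (Pi.single b₁ 1)) b *
          ⟪toEj P j (Pi.single b₁ 1), CE P ((P.eta k) ^ P.d) ((P.L : ℝ) ^ k) j (toEj P j (Pi.single b₂ 1))⟫ *
          HkE P ((P.eta k) ^ P.d) ((P.L : ℝ) ^ k) j (toEj P j (Pi.single b₂ 1)) b''| ≤
        M ^ 2 * MC * K * ((((P.d - 2 + 1).factorial : ℝ) / (a₀ ^ (P.d - 2 + 1) * (P.L : ℝ) ^ (k - j))) *
          Real.exp (-(a₀ / 2 * D))) := by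
    intro j hjm
    have hjk : j < k := Finset.mem_range.1 hjm
    have hj : j ≤ P.m + P.K := by omega
    refine (abs_termDk_le hd hj hjk.le ha hδ hδC (hH j hj hjk) (hC j hjk) b b'').trans ?_
    set ℓ : ℝ := (P.L : ℝ) ^ (k - j) with hℓ
    have hℓ1 : 1 ≤ ℓ := one_le_pow₀ (by exact_mod_cast P.L_pos)
    have hℓ0 : 0 < ℓ := by linarith
    have e1 : (supDist b.src b''.src : ℝ) / (P.L : ℝ) ^ j = ℓ * D := by
      rw [hDdef, pow_eq_pow_mul_pow' hjk.le, ← hℓ]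
      field_simp
    have h1 : M ^ 2 * (MC * ℓ ^ (P.d - 2)) * (P.d : ℝ) ^ 2 * (Real.exp (a₀ / 2) * ((2 * (1 + P.d / a₀)) ^ P.d) ^ 2) *
          Real.exp (-(a₀ * (ℓ * D))) = M ^ 2 * MC * K * (ℓ ^ (P.d - 2) * Real.exp (-(a₀ * (ℓ * D)))) := by
      rw [hK]; ring
    have h2 : Real.exp (-(a₀ * (ℓ * D))) ≤ Real.exp (-(a₀ * ℓ)) * Real.exp (-(a₀ / 2 * D)) := by
      rw [← Real.exp_add]
      refine Real.exp_le_exp.2 ?_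
      nlinarith [mul_nonneg (sub_nonneg.2 hℓ1) (sub_nonneg.2 hD1), ha₀p.le, mul_nonneg ha₀p.le (sub_nonneg.2 hD1),
        mul_nonneg ha₀p.le (mul_nonneg (sub_nonneg.2 hℓ1) (sub_nonneg.2 hD1))]
    have h4 : ℓ ^ (P.d - 2) * Real.exp (-(a₀ * ℓ)) ≤ ((P.d - 2 + 1).factorial : ℝ) / (a₀ ^ (P.d - 2 + 1) * ℓ) :=
      pow_mul_exp_neg_le ha₀p hℓ0 (P.d - 2)
    rw [e1, h1]
    refine mul_le_mul_of_nonneg_left ?_ (by positivity)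
    calc ℓ ^ (P.d - 2) * Real.exp (-(a₀ * (ℓ * D)))
        ≤ ℓ ^ (P.d - 2) * (Real.exp (-(a₀ * ℓ)) * Real.exp (-(a₀ / 2 * D))) := mul_le_mul_of_nonneg_left h2 (by positivity)
      _ = ℓ ^ (P.d - 2) * Real.exp (-(a₀ * ℓ)) * Real.exp (-(a₀ / 2 * D)) := by ring
      _ ≤ ((P.d - 2 + 1).factorial : ℝ) / (a₀ ^ (P.d - 2 + 1) * ℓ) * Real.exp (-(a₀ / 2 * D)) :=
          mul_le_mul_of_nonneg_right h4 (Real.exp_pos _).le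
  calc _ ≤ ∑ j ∈ Finset.range k, M ^ 2 * MC * K *
          ((((P.d - 2 + 1).factorial : ℝ) / (a₀ ^ (P.d - 2 + 1) * (P.L : ℝ) ^ (k - j))) * Real.exp (-(a₀ / 2 * D))) :=
        (Finset.abs_sum_le_sum_abs _ _).trans (Finset.sum_le_sum hterm)
    _ = M ^ 2 * MC * K * (((P.d - 2 + 1).factorial : ℝ) / a₀ ^ (P.d - 2 + 1)) * Real.exp (-(a₀ / 2 * D)) *
          ∑ j ∈ Finset.range k, ((P.L : ℝ) ^ (k - j))⁻¹ := by
        rw [Finset.mul_sum]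
        refine Finset.sum_congr rfl fun j _ => ?_
        field_simp
    _ ≤ M ^ 2 * MC * K * (((P.d - 2 + 1).factorial : ℝ) / a₀ ^ (P.d - 2 + 1)) * Real.exp (-(a₀ / 2 * D)) * 1 :=
        mul_le_mul_of_nonneg_left (sum_inv_pow_le_one k) (by positivity)
    _ = _ := by rw [mul_one]

/-! ## §4  Assembly: the sentence of p. 326 on the tori given only [6I] Proposition 1.2 -/

/-- **`𝒟_k` DECAYS EXPONENTIALLY ON THE TORI, FROM THE TYPED (7.2.2) AND THE NATIVE (7.2.3)**, constants UNIFORM IN `k`: given r15's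
`KernelData.Ineq722` for p09's kernel family (scales covering the standing range) and (7.2.3) for the unit-lattice matrices in the
binder shape `∀ k ≤ m + K, ∀ j < k`: `∃ R₀ c₀ δ′, 0 < δ′ ∧ 0 ≤ c₀ ∧ ∀ k ≤ m + K, ∀ b b″, R₀ ≤ |b₋ − b″₋|_∞/L^k → |𝒟_k(b, b″)| ≤
c₀e^{−δ′|b₋ − b″₋|_∞/L^k}` for p11's `𝒟_k = DkE P η_k^d L^k k`. [cite: BalabanImbrieJaffe1985, (4.4.4) p.312] -/
theorem decayDk_torus_of_ineq722_lt (hd : 2 ≤ P.d) {lev : ℕ → ℕ} (hlev : ∀ i, lev i ≤ P.m + P.K)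
    (hcov : ∀ j ≤ P.m + P.K, ∃ i, lev i = j) {a : ℝ} (ha : 0 < a) {BondU : ℕ → Type}
    {distEB : (i : ℕ) → TSite P 0 → BondU i → ℝ} {Cker : (i : ℕ) → Fin P.d → Fin P.d → TSite P (lev i) → TSite P (lev i) → ℝ}
    {Dker : (i : ℕ) → TSite P 0 → BondU i → ℝ}
    (h722 : KernelData.Ineq722
      (fun i => torusKernelData P (lev i) (deltaAData (hlev i) a) (BondU i) (distEB i) (Cker i) (Dker i)))
    {δC MC : ℝ} (hδC : 0 < δC) (hMC : 0 ≤ MC)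
    (hC : ∀ k ≤ P.m + P.K, ∀ j < k, ∀ b₁ b₂ : PBond P j, |⟪toEj P j (Pi.single b₁ 1),
      CE P ((P.eta j) ^ P.d) ((P.L : ℝ) ^ j) j (toEj P j (Pi.single b₂ 1))⟫| ≤ MC * Real.exp (-(δC * (supDist b₁.src b₂.src : ℝ)))) :
    ∃ R₀ c₀ δ' : ℝ, 0 < δ' ∧ 0 ≤ c₀ ∧ ∀ (k : ℕ) (hk : k ≤ P.m + P.K) (b b'' : PBond P 0),
        R₀ ≤ (supDist b.src b''.src : ℝ) / (P.L : ℝ) ^ k →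
        |DkE P ((P.eta k) ^ P.d) ((P.L : ℝ) ^ k) k (toE P (Pi.single b'' 1)) b| ≤
          c₀ * Real.exp (-δ' * ((supDist b.src b''.src : ℝ) / (P.L : ℝ) ^ k)) := by
  obtain ⟨δ, M, hδ, -, hBall⟩ := exists_bound_of_ineq722 hlev h722
  refine ⟨2, M ^ 2 * MC * ((P.d : ℝ) ^ 2 * (Real.exp (min δ δC / 2 / 2) * ((2 * (1 + P.d / (min δ δC / 2))) ^ P.d) ^ 2)) *
      (((P.d - 2 + 1).factorial : ℝ) / (min δ δC / 2) ^ (P.d - 2 + 1)),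
    min δ δC / 2 / 2, by positivity, by positivity, fun k hk b b'' hfar => ?_⟩
  have hH : ∀ (j : ℕ) (hj : j ≤ P.m + P.K), j < k → ∀ (μ ν : Fin P.d) (x : TSite P 0) (y : TSite P j),
      |(torusRep P j (deltaAData hj a)).H (x, μ) (y, ν)| ≤ M * Real.exp (-(δ * distEU P j x y)) := by
    intro j hj _ μ ν x y
    obtain ⟨i, hi⟩ := hcov j hj
    subst hi
    exact (le_add_of_nonneg_right torusKernelData_gradH_nonneg).trans (hBall i μ ν x y)
  rw [neg_mul]
  exact abs_dkKernel_le hd hk ha hδ hδC hMC hH (fun j hjk => hC k hk j hjk) hfar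

/-- **THE SENTENCE OF p. 326 ON THE TORI GIVEN ONLY [6I] PROPOSITION 1.2 BY ITS TREE NAME** (`B5.Prop12Printed` for p09's family of
scales `levStd` — the `h12` of rows C1.Eq7.2.1-7.2.2 / C2.Eq2.16): *"The operators 𝒟_k have the same properties as the operators G_k in
[6I], Proposition 1.2, with exponential decay …"* — `∃ R₀ c₀ δ′, 0 < δ′ ∧ 0 ≤ c₀ ∧ ∀ k ≤ m + K, ∀ b b″, R₀ ≤ |b₋ − b″₋|_∞/L^k →
|𝒟_k(b, b″)| ≤ c₀e^{−δ′|b₋ − b″₋|_∞/L^k}` for the `𝒟_k` OF RECORD; (7.2.2) via p09's `ineq722_deltaA_of_prop12Printed`, (7.2.3) HYPOTHESIS-FREE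
by p09's `ineq723_CE_lt`. [cite: BalabanImbrieJaffe1985, (4.4.4) p.312] -/
theorem decayDk_torus_prop12 (hd : 2 ≤ P.d) {a : ℝ} (ha : 0 < a)
    (h12 : B5.Prop12Printed (fun i => settingOf (torusRep P (levStd P i) (deltaAData (levStd_le i) a)) i)) :
    ∃ R₀ c₀ δ' : ℝ, 0 < δ' ∧ 0 ≤ c₀ ∧ ∀ (k : ℕ) (hk : k ≤ P.m + P.K) (b b'' : PBond P 0),
        R₀ ≤ (supDist b.src b''.src : ℝ) / (P.L : ℝ) ^ k →
        |DkE P ((P.eta k) ^ P.d) ((P.L : ℝ) ^ k) k (toE P (Pi.single b'' 1)) b| ≤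
          c₀ * Real.exp (-δ' * ((supDist b.src b''.src : ℝ) / (P.L : ℝ) ^ k)) := by
  obtain ⟨MC, δC, hMC, hδC, hC⟩ := ineq723_CE_torus (P := P) hd
  exact decayDk_torus_of_ineq722_lt hd levStd_le (fun j hj => ⟨j, min_eq_left hj⟩) ha
    (ineq722_deltaA_of_prop12Printed (levStd P) levStd_le ha (fun _ => PUnit) (fun _ _ _ => 0) (fun _ _ _ _ _ => 0)
      (fun _ _ _ => 0) h12) hδC hMC.le hC

end

end Literature.MathematicalPhysics.QuantumFieldTheory.BalabanImbrieJaffe1984to88.BIJ85CurlyDkDecayTorus
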